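import Mathlib

/-!
# Skew-cut certificate: the kernel-checkable algebra (selfsim g3, cell `ns-blowup`, 2026-08-25)

HONEST FRAMING (human ruling D-0035): nothing here is a claim about Navier–Stokes blow-up.
WHAT THIS IS NOT: not NS evidence. These are the finite-dimensional / pointwise lemmas behind the
SKEW-CUT CERTIFICATE of `selfsim/SKEWCUT-CERT.md` (a-posteriori certification format for one real
eigenvalue of the MODEL operator «NS linearised about the forced ABC flow», crux X0 of lane N1*).
The functional-analytic steps (Lax–Milgram on the Fourier tail, Rellich compactness of Galerkin
eigenvectors) stay paper-grade in that note; what is kernel here is exactly: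

* `abc_strain_offdiag_sq` — LEMMA S, the trigonometric identity
  `(cos x − sin y)² + (cos z − sin x)² + (cos y − sin z)² = 6 − |U|²` for
  `U = abc(1,1,1) = (sin z + cos y, sin x + cos z, sin y + cos x)`; hence the off-diagonal strain
  entries `a = ½(cos x − sin y)`, `b = ½(cos z − sin x)`, `c = ½(cos y − sin z)` satisfy
  `a² + b² + c² ≤ 3/2` (`abc_strain_offdiag_sq_le`).
* `strain_form_sq_le` / `abc_strain_form_abs_le` — for the traceless symmetric strain
  `S = [[0,a,b],[a,0,c],[b,c,0]]` the quadratic form `vᵀSv = 2(a v₁v₂ + b v₁v₃ + c v₂v₃)` obeys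
  `|vᵀSv| ≤ √2‖v‖²` pointwise: the EXACT stretching bound `s = √2` used in both certificate
  inequalities (Cauchy–Schwarz plus `3(v₁²v₂² + v₁²v₃² + v₂²v₃²) ≤ ‖v‖⁴`).
* `re_inner_sub_ge` — LEMMA 3.1 (inverse-free «completing the square»): if `Re⟪u, Pu⟫ ≥ 0` for all
  `u` and `d` solves `Re⟪Pd, u⟫ + Re⟪d, Pu⟫ = Re⟪c, u⟫` for all `u` (i.e. `2·(Re P) d = c`), then
  `Re⟪w, Pw⟫ − Re⟪w, c⟫ ≥ −Re⟪d, Pd⟫` for every `w` — the step that bounds the head↔tail cross term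
  by `¼ c* H⁻¹ c` with `H = Re P` the Hermitian part of the boundary Schur complement.
* `hermitianPart_congr` — LEMMA 3.2 (the skew-cut identity): for `N P = P N = 1`,
  `N (P + Pᴴ) Nᴴ = N + Nᴴ = Nᴴ (P + Pᴴ) N`; this is why the NORM of `N = P⁻¹` (which carries the
  advection) never enters the certificate, only `λ_min` of `½(P + Pᴴ)`.
* `det_fromBlocks_mul_det_pos` — THEOREM 1(b) finite core: with `A` invertible and the Schur
  complement accretive, `det [[A,B],[C,D]]` and `det A` have the same sign.
* `exists_eigenvalue_of_det_sign_change` — THEOREM 2(i) finite core: opposite signs of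
  `det(x·1 − M)` at `x₁ < x₂` ⇒ a real eigenvalue of `M` in `(x₁, x₂)` with a real eigenvector.
* `det_pos_of_dotProduct_mulVec_pos` — LEMMA 3.3: a real square matrix whose quadratic form is
  positive definite has positive determinant (homotopy to the identity + intermediate value
  theorem); used to transport the SIGN of `det` of a certified K-section to every finer section.

Mathlib only; no new definitions.
-/

namespace Summit.NavierStokesRegularity.FluidComputer.SkewCutCertificate

open Real

section Strain

/-- **Lemma S (identity).** For `U = abc(1,1,1)`, four times the sum of squares of the off-diagonal
strain entries equals `6 − |U|²`:
`(cos x − sin y)² + (cos z − sin x)² + (cos y − sin z)² = 6 − ((sin z + cos y)² + (sin x + cos z)² + (sin y + cos x)²)`. -/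
theorem abc_strain_offdiag_sq (x y z : ℝ) :
    (cos x - sin y) ^ 2 + (cos z - sin x) ^ 2 + (cos y - sin z) ^ 2
      = 6 - ((sin z + cos y) ^ 2 + (sin x + cos z) ^ 2 + (sin y + cos x) ^ 2) := by
  linear_combination (2 : ℝ) * sin_sq_add_cos_sq x + (2 : ℝ) * sin_sq_add_cos_sq y
    + (2 : ℝ) * sin_sq_add_cos_sq z

/-- **Lemma S (bound).** The off-diagonal strain entries `a = ½(cos x − sin y)`,
`b = ½(cos z − sin x)`, `c = ½(cos y − sin z)` of `abc(1,1,1)` satisfy `a² + b² + c² ≤ 3/2`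
(equality exactly where `U = 0`, i.e. at the eight stagnation points). -/
theorem abc_strain_offdiag_sq_le (x y z : ℝ) :
    ((cos x - sin y) / 2) ^ 2 + ((cos z - sin x) / 2) ^ 2 + ((cos y - sin z) / 2) ^ 2 ≤ 3 / 2 := by
  have h := abc_strain_offdiag_sq x y z
  nlinarith [sq_nonneg (sin z + cos y), sq_nonneg (sin x + cos z), sq_nonneg (sin y + cos x)]

/-- **Traceless strain form, squared bound.** If `a² + b² + c² ≤ 3/2` then the quadratic form of
`S = [[0,a,b],[a,0,c],[b,c,0]]`, namely `vᵀSv = 2(a v₁v₂ + b v₁v₃ + c v₂v₃)`, satisfies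
`(vᵀSv)² ≤ 2‖v‖⁴`. (Cauchy–Schwarz and `3(v₁²v₂² + v₁²v₃² + v₂²v₃²) ≤ (v₁² + v₂² + v₃²)²`.) -/
theorem strain_form_sq_le {a b c : ℝ} (habc : a ^ 2 + b ^ 2 + c ^ 2 ≤ 3 / 2) (v₁ v₂ v₃ : ℝ) :
    (2 * (a * v₁ * v₂ + b * v₁ * v₃ + c * v₂ * v₃)) ^ 2 ≤ 2 * (v₁ ^ 2 + v₂ ^ 2 + v₃ ^ 2) ^ 2 := by
  -- Cauchy–Schwarz in ℝ³ (Lagrange identity form)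
  have hCS : (a * (v₁ * v₂) + b * (v₁ * v₃) + c * (v₂ * v₃)) ^ 2
      ≤ (a ^ 2 + b ^ 2 + c ^ 2) * ((v₁ * v₂) ^ 2 + (v₁ * v₃) ^ 2 + (v₂ * v₃) ^ 2) := by
    nlinarith [sq_nonneg (a * (v₁ * v₃) - b * (v₁ * v₂)), sq_nonneg (a * (v₂ * v₃) - c * (v₁ * v₂)),
      sq_nonneg (b * (v₂ * v₃) - c * (v₁ * v₃))]
  -- Maclaurin: 3 e₂(v₁²,v₂²,v₃²) ≤ e₁²
  have hM : 3 * ((v₁ * v₂) ^ 2 + (v₁ * v₃) ^ 2 + (v₂ * v₃) ^ 2) ≤ (v₁ ^ 2 + v₂ ^ 2 + v₃ ^ 2) ^ 2 := by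
    nlinarith [sq_nonneg (v₁ ^ 2 - v₂ ^ 2), sq_nonneg (v₁ ^ 2 - v₃ ^ 2), sq_nonneg (v₂ ^ 2 - v₃ ^ 2)]
  have hE : 0 ≤ (v₁ * v₂) ^ 2 + (v₁ * v₃) ^ 2 + (v₂ * v₃) ^ 2 := by positivity
  have h3 : (a * (v₁ * v₂) + b * (v₁ * v₃) + c * (v₂ * v₃)) ^ 2
      ≤ (3 / 2) * ((v₁ * v₂) ^ 2 + (v₁ * v₃) ^ 2 + (v₂ * v₃) ^ 2) :=
    hCS.trans (mul_le_mul_of_nonneg_right habc hE)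
  have hre : a * v₁ * v₂ + b * v₁ * v₃ + c * v₂ * v₃
      = a * (v₁ * v₂) + b * (v₁ * v₃) + c * (v₂ * v₃) := by ring
  rw [hre]
  nlinarith [h3, hM]

/-- **Exact stretching bound `s = √2` for `abc(1,1,1)`.** With `S(x,y,z)` the symmetric part of
`∇U` (zero diagonal; off-diagonal entries `½(cos x − sin y)`, `½(cos z − sin x)`, `½(cos y − sin z)`),
`|vᵀ S v| ≤ √2 (v₁² + v₂² + v₃²)` for every real `v` and every point — the constant entering
`m_t = x + ν(K+1)² − s` and `θ_K ≤ s/√h_K` in the certificate. (For complex `v` apply it to real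
and imaginary parts.) -/
theorem abc_strain_form_abs_le (x y z v₁ v₂ v₃ : ℝ) :
    |2 * ((cos x - sin y) / 2 * v₁ * v₂ + (cos z - sin x) / 2 * v₁ * v₃ + (cos y - sin z) / 2 * v₂ * v₃)|
      ≤ Real.sqrt 2 * (v₁ ^ 2 + v₂ ^ 2 + v₃ ^ 2) := by
  set p := 2 * ((cos x - sin y) / 2 * v₁ * v₂ + (cos z - sin x) / 2 * v₁ * v₃
    + (cos y - sin z) / 2 * v₂ * v₃) with hp
  set q := v₁ ^ 2 + v₂ ^ 2 + v₃ ^ 2 with hq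
  have hq0 : 0 ≤ q := by positivity
  have hsq : p ^ 2 ≤ 2 * q ^ 2 := strain_form_sq_le (abc_strain_offdiag_sq_le x y z) v₁ v₂ v₃
  have h1 : |p| = Real.sqrt (p ^ 2) := (Real.sqrt_sq_eq_abs p).symm
  have h2 : Real.sqrt (p ^ 2) ≤ Real.sqrt (2 * q ^ 2) := Real.sqrt_le_sqrt hsq
  have h3 : Real.sqrt (2 * q ^ 2) = Real.sqrt 2 * q := by
    rw [Real.sqrt_mul (by norm_num : (0:ℝ) ≤ 2), Real.sqrt_sq hq0]
  calc |p| = Real.sqrt (p ^ 2) := h1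
    _ ≤ Real.sqrt (2 * q ^ 2) := h2
    _ = Real.sqrt 2 * q := h3

end Strain

section Square

variable {𝕜 : Type*} {E : Type*} [RCLike 𝕜] [NormedAddCommGroup E] [InnerProductSpace 𝕜 E]

/-- **Lemma 3.1 (completing the square, inverse-free).** Let `P` be accretive
(`Re⟪u, Pu⟫ ≥ 0` for all `u`) and let `d` solve the «Hermitian-part equation»
`Re⟪Pd, u⟫ + Re⟪d, Pu⟫ = Re⟪c, u⟫` for all `u` (for matrices: `(P + Pᴴ) d = c`). Then for every `w`,
`Re⟪w, Pw⟫ − Re⟪w, c⟫ ≥ −Re⟪d, Pd⟫` (`= −¼ c* H⁻¹ c`, `H = ½(P + Pᴴ)`): the sharp lower bound of the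
head↔tail cross term in the skew-cut certificate, in which only the Hermitian part of the boundary
Schur complement `P` appears. Proof: expand `0 ≤ Re⟪w − d, P(w − d)⟫`. -/
theorem re_inner_sub_ge (P : E →ₗ[𝕜] E) (hP : ∀ u : E, 0 ≤ RCLike.re (inner 𝕜 u (P u))) (c d : E)
    (hd : ∀ u : E, RCLike.re (inner 𝕜 (P d) u) + RCLike.re (inner 𝕜 d (P u))
      = RCLike.re (inner 𝕜 c u)) (w : E) :
    -(RCLike.re (inner 𝕜 d (P d))) ≤ RCLike.re (inner 𝕜 w (P w)) - RCLike.re (inner 𝕜 w c) := by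
  have h0 := hP (w - d)
  have e1 : inner 𝕜 (w - d) (P (w - d))
      = inner 𝕜 w (P w) - inner 𝕜 w (P d) - inner 𝕜 d (P w) + inner 𝕜 d (P d) := by
    rw [map_sub, inner_sub_left, inner_sub_right, inner_sub_right]; ring
  rw [e1, map_add, map_sub, map_sub] at h0
  have hsym : RCLike.re (inner 𝕜 w (P d)) = RCLike.re (inner 𝕜 (P d) w) := inner_re_symm _ _
  have hcw : RCLike.re (inner 𝕜 w c) = RCLike.re (inner 𝕜 c w) := inner_re_symm _ _
  have := hd w
  linarith

end Square

section Identity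

open scoped Matrix

variable {n : Type*} [Fintype n] [DecidableEq n] {R : Type*} [CommRing R] [StarRing R]

/-- **Lemma 3.2 (the skew-cut identity).** If `N P = 1` and `P N = 1` then
`N (P + Pᴴ) Nᴴ = N + Nᴴ` and `Nᴴ (P + Pᴴ) N = N + Nᴴ`: the Hermitian part of `N = P⁻¹` is congruent
(by `N` and by `Nᴴ`) to the Hermitian part of `P`. Consequently `Re N > 0 ⟺ Re P > 0` and
`N (Re N)⁻¹ Nᴴ = (Re P)⁻¹`, so `‖N (Re N)⁻¹ Nᴴ‖ = 1/λ_min(Re P)` whatever the norm of `N` — in the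
certificate, `N` is the shell block of the resolvent of the K-section and carries the advection;
only `λ_min` of the Hermitian part of the boundary Schur complement `P` survives. -/
theorem hermitianPart_congr (N P : Matrix n n R) (hNP : N * P = 1) (hPN : P * N = 1) :
    N * (P + Pᴴ) * Nᴴ = N + Nᴴ ∧ Nᴴ * (P + Pᴴ) * N = N + Nᴴ := by
  constructor
  · have h1 : N * Pᴴ * Nᴴ = N := by
      rw [Matrix.mul_assoc, ← Matrix.conjTranspose_mul, hNP, Matrix.conjTranspose_one,
        Matrix.mul_one]
    have h2 : N * P * Nᴴ = Nᴴ := by rw [hNP, Matrix.one_mul]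
    rw [Matrix.mul_add, Matrix.add_mul, h1, h2, add_comm]
  · have h1 : Nᴴ * Pᴴ * N = N := by
      rw [← Matrix.conjTranspose_mul, hPN, Matrix.conjTranspose_one, Matrix.one_mul]
    have h2 : Nᴴ * P * N = Nᴴ := by rw [Matrix.mul_assoc, hPN, Matrix.mul_one]
    rw [Matrix.mul_add, Matrix.add_mul, h1, h2, add_comm]

end Identity

section Determinant

variable {n : Type*} [Fintype n] [DecidableEq n]

/-- **Lemma 3.3 (real accretive ⇒ positive determinant).** If the quadratic form of a real square
matrix `Q` is positive definite, `0 < v ⬝ᵥ (Q *ᵥ v)` for all `v ≠ 0` (no symmetry assumed), then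
`0 < det Q`. Proof: every `Q_t = (1 − t)·1 + t·Q`, `t ∈ [0,1]`, has the same property, hence is
nonsingular; `t ↦ det Q_t` is continuous with `det Q_0 = 1`, so by the intermediate value theorem
`det Q_1 = det Q` cannot be `≤ 0`. In the certificate: the Schur factor of a certified K-section
inside any finer section is real (real operator) and accretive, so its determinant is positive and
the sign of `det` is the same for all finer sections. -/
theorem det_pos_of_dotProduct_mulVec_pos (Q : Matrix n n ℝ)
    (hQ : ∀ v : n → ℝ, v ≠ 0 → 0 < dotProduct v (Q.mulVec v)) : 0 < Q.det := by
  -- the homotopy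
  let M : ℝ → Matrix n n ℝ := fun t => (1 - t) • (1 : Matrix n n ℝ) + t • Q
  have hM0 : (M 0).det = 1 := by simp [M]
  have hM1 : (M 1).det = Q.det := by simp [M]
  -- nonsingular along the path
  have hne : ∀ t ∈ Set.Icc (0:ℝ) 1, (M t).det ≠ 0 := by
    intro t ht hdet
    obtain ⟨v, hv, hMv⟩ := (Matrix.exists_mulVec_eq_zero_iff).mpr hdet
    have hform : dotProduct v ((M t).mulVec v)
        = (1 - t) * dotProduct v v + t * dotProduct v (Q.mulVec v) := by
      simp only [M, Matrix.add_mulVec, Matrix.smul_mulVec, Matrix.one_mulVec, dotProduct_add,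
        dotProduct_smul, smul_eq_mul]
    have hvv : 0 < dotProduct v v := by
      rcases Function.ne_iff.mp hv with ⟨i, hi⟩
      calc (0:ℝ) < v i * v i := mul_self_pos.mpr hi
        _ ≤ dotProduct v v := by
          unfold dotProduct
          exact Finset.single_le_sum (f := fun j => v j * v j) (fun j _ => mul_self_nonneg (v j))
            (Finset.mem_univ i)
    have hq := hQ v hv
    have ht0 : 0 ≤ t := ht.1
    have ht1 : 0 ≤ 1 - t := by linarith [ht.2]
    have hpos : 0 < (1 - t) * dotProduct v v + t * dotProduct v (Q.mulVec v) := by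
      rcases lt_or_eq_of_le ht0 with hpos_t | hzero
      · have := mul_pos hpos_t hq; nlinarith [mul_nonneg ht1 hvv.le]
      · subst hzero; simp [hvv]
    rw [hMv, dotProduct_zero] at hform
    linarith
  -- continuity of t ↦ det (M t)
  have hcont : Continuous fun t => (M t).det := by
    apply Continuous.matrix_det
    fun_prop
  -- intermediate value argument
  by_contra hle
  have hle : Q.det ≤ 0 := not_lt.mp hle
  have hsub := intermediate_value_Icc' (zero_le_one : (0:ℝ) ≤ 1) hcont.continuousOn
  have hmem : (0:ℝ) ∈ Set.Icc ((fun t => (M t).det) 1) ((fun t => (M t).det) 0) := by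
    simp only [hM0, hM1]; exact ⟨hle, zero_le_one⟩
  obtain ⟨t, ht, ht0⟩ := hsub hmem
  exact hne t ht ht0

end Determinant

section SignTransport

variable {m n : Type*} [Fintype m] [Fintype n] [DecidableEq m] [DecidableEq n]

/-- **Theorem 1(b), finite-dimensional core: sign transport through an accretive Schur factor.**
For a real block matrix `M = [[A, B], [C, D]]` with `A` invertible whose Schur complement
`S = D − C A⁻¹ B` has positive definite quadratic form (`0 < v ⬝ᵥ (S *ᵥ v)` for `v ≠ 0`; no symmetry
assumed), `det M` and `det A` have the SAME SIGN: `0 < det M · det A`. (Mathlib's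
`det M = det A · det S` plus `det_pos_of_dotProduct_mulVec_pos`.) In the skew-cut certificate `A` is
the certified K-section `A⁽ᴷ⁾(x)`, `M` any finer section `A⁽ᴷ′⁾(x)`, and the accretivity of `S` is
what inequality (I1)∧(I2) / (I*) delivers; hence every finer section has an eigenvalue in a bracket
whose endpoints carry opposite certified signs. -/
theorem det_fromBlocks_mul_det_pos (A : Matrix m m ℝ) (B : Matrix m n ℝ) (C : Matrix n m ℝ)
    (D : Matrix n n ℝ) [Invertible A]
    (hS : ∀ v : n → ℝ, v ≠ 0 → 0 < dotProduct v ((D - C * ⅟A * B).mulVec v)) :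
    0 < (Matrix.fromBlocks A B C D).det * A.det := by
  rw [Matrix.det_fromBlocks₁₁]
  have hSpos : 0 < (D - C * ⅟A * B).det := det_pos_of_dotProduct_mulVec_pos _ hS
  have hA : A.det ≠ 0 := (A.isUnit_det_of_invertible).ne_zero
  have hA2 : 0 < A.det * A.det := mul_self_pos.mpr hA
  have : A.det * (D - C * ⅟A * B).det * A.det = (A.det * A.det) * (D - C * ⅟A * B).det := by ring
  rw [this]
  exact mul_pos hA2 hSpos

end SignTransport

section Bracket

variable {n : Type*} [Fintype n] [DecidableEq n]

/-- **Theorem 2(i), finite core: a determinant sign change brackets a real eigenvalue.** If the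
real matrix family `x ↦ x·1 − M` has determinants of opposite signs at `x₁ < x₂`, then `M` has a
real eigenvalue `x ∈ (x₁, x₂)` with a real eigenvector. (Continuity of `det` + intermediate value
theorem + `det = 0 ⇔ ∃ v ≠ 0, (x·1 − M) v = 0`.) In the skew-cut certificate this is applied to
every Galerkin section `L_{K′}`, `K′ ≥ K`, once `det_fromBlocks_mul_det_pos` has transported the
certified signs from level `K`. -/
theorem exists_eigenvalue_of_det_sign_change (M : Matrix n n ℝ) {x₁ x₂ : ℝ} (hlt : x₁ < x₂)
    (hsign : (x₁ • (1 : Matrix n n ℝ) - M).det * (x₂ • (1 : Matrix n n ℝ) - M).det < 0) :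
    ∃ x ∈ Set.Ioo x₁ x₂, ∃ v : n → ℝ, v ≠ 0 ∧ M.mulVec v = x • v := by
  let f : ℝ → ℝ := fun x => (x • (1 : Matrix n n ℝ) - M).det
  have hcont : Continuous f := by
    apply Continuous.matrix_det
    fun_prop
  have h1 : f x₁ ≠ 0 := fun h => by simp [f] at h; rw [h, zero_mul] at hsign; exact lt_irrefl 0 hsign
  have h2 : f x₂ ≠ 0 := fun h => by simp [f] at h; rw [h, mul_zero] at hsign; exact lt_irrefl 0 hsign
  -- a zero of f in [x₁, x₂]
  have hzero : ∃ x ∈ Set.Icc x₁ x₂, f x = 0 := by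
    rcases mul_neg_iff.mp hsign with ⟨ha, hb⟩ | ⟨ha, hb⟩
    · -- f x₁ > 0 > f x₂
      have hsub := intermediate_value_Icc' hlt.le hcont.continuousOn
      exact hsub ⟨hb.le, ha.le⟩
    · -- f x₁ < 0 < f x₂
      have hsub := intermediate_value_Icc hlt.le hcont.continuousOn
      exact hsub ⟨ha.le, hb.le⟩
  obtain ⟨x, hx, hfx⟩ := hzero
  have hx1 : x ≠ x₁ := fun h => h1 (h ▸ hfx)
  have hx2 : x ≠ x₂ := fun h => h2 (h ▸ hfx)
  refine ⟨x, ⟨lt_of_le_of_ne hx.1 (Ne.symm hx1), lt_of_le_of_ne hx.2 hx2⟩, ?_⟩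
  obtain ⟨v, hv, hMv⟩ := (Matrix.exists_mulVec_eq_zero_iff).mpr hfx
  refine ⟨v, hv, ?_⟩
  have : (x • (1 : Matrix n n ℝ) - M).mulVec v = x • v - M.mulVec v := by
    rw [Matrix.sub_mulVec, Matrix.smul_mulVec, Matrix.one_mulVec]
  rw [this] at hMv
  exact (sub_eq_zero.mp hMv).symm

end Bracket

end Summit.NavierStokesRegularity.FluidComputer.SkewCutCertificate
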